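import Summits.NavierStokesRegularity.NavierStokesRegularity.Theorems.ScenarioCensusRowF1ax
import Summits.NavierStokesRegularity.NavierStokesRegularity.Theorems.ScenarioCensusRowA7h
import Summits.NavierStokesRegularity.NavierStokesRegularity.Theorems.DssFarFieldSlavingBlowupTypeIDssProfileSimilarityEnstrophyBeltramiLiouville
import Summits.NavierStokesRegularity.NavierStokesRegularity.Theorems.SqueezeCycleSingularZoomWindow
import Summits.NavierStokesRegularity.NavierStokesRegularity.Theorems.ClockStretchingLawClockCeilingZoomDerivLimit
import Summits.NavierStokesRegularity.NavierStokesRegularity.Theorems.PoloidalWindowDoorPoloidalWindowRigidityVorticityTranslate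
import Literature.Analysis.FluidPDE.TypeIAncientMild
import Literature.Analysis.FluidPDE.WholeSpaceIBP
import Literature.Analysis.FluidPDE.ClassicalSolutionCalculus
import Literature.Analysis.FluidPDE.VorticityEquation
import Literature.Analysis.FluidPDE.TypeIAncientMildClassical
import HarnessLib
import Summits.NavierStokesRegularity.NavierStokesRegularity.Theorems.ScenarioCensusRowF1IntQuenchTop
import Summits.NavierStokesRegularity.NavierStokesRegularity.Theorems.ScenarioCensusRowF1Socket

/-!
# Census row F1, the EULERIAN PINCER (cells F1ie / F1if; floors DE / DF) — LINE 25 «eulerian-pincer» port, part 1/4: §1 (new part) the EULERIAN read-outs `ebbOf θ` /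
# `flareOf κ` — the fixed-point rate of the enstrophy density against the self-similar rate — their calculus and dictionary.  The frame of §1, §2–§5 and §7 of the line
# are LINES 18/20/22/24/27 VERBATIM and are taken BY NAME from the landed ports (names spelled by namespace; not re-declared)

Re-homed for the scenario census (typer seat ns-census-typer-1 g9; the cells F1ie / F1if and the floors DE / DF are MEMBERS OF RECORD «DECIDED IN KERNEL IN FILES» of row F1
since census v1.77 (critic backstop idea-crit-7 PASS 03:14Z; ref ns-census-ref g10 PRE-CHECK ✓ §15.17 item 41; lead-presearch label); this port makes them TREE-decided):
VERBATIM PORT of the NEW declarations (§1 read-outs, §6 kill, §8 rows) of ns-idea-3 LINE 25 «eulerian-pincer»,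
`pub/ideators/ns-idea-3/lines/eulerian-pincer/line-eulerian-pincer.lean` sha16 b2a1952cbeded9c7 (1972 l., lean check rc 0, 0 sorry; the frame of §1, §2–§5 and §7 are
shared VERBATIM with LINES 18/20/22/24/27 and taken BY NAME from the landed ports — not re-declared), split for the 400-line rule into `ScenarioCensusRowF1Pincer` (§1
read-outs) → `…PincerKill` (§6) → `…PincerRows` (§8 numbers/rows) → `…PincerTop` (§8 verdicts + census KEYS).  Lean text VERBATIM in namespace
`…Theorems.ScenarioCensus.EulerianPincer` (the line's `…Cruxes.ScenarioCensusRowF1.EulerianPincerLine` re-homed), shared names spelled by namespace (`LiouvilleSocket.…`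
frame / τ-tool, `FrozenTop.…`, `InviscidTop.…`, `IntegratedStretch.…`, …); port edits: the bracket lines `section …` / `end …` dropped (no `variable`s), `@[conjecture]`
on the residual `PincerSlack` (≡ `ScenarioCensus.Row_F1`, OPEN), one-line docstrings added where missing (gate lint).  Statements untouched.

No census VALUE is moved here (row F1 stays OPEN-WITH-LINE; the members become TREE-decided by name); NS regularity is NOT proved; `Row_F1` is untouched (zero
movement, `pincerSlack_iff_rowF1`); no summit statement is proved by this file.
-/

-- the summit and its single problem share the name `NavierStokesRegularity` (D-0017 nested layout)
set_option linter.dupNamespace false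

noncomputable section

open MeasureTheory Set Function Filter TopologicalSpace Metric
open scoped Topology NNReal ENNReal InnerProductSpace RealInnerProductSpace Laplacian

namespace Summit.NavierStokesRegularity.NavierStokesRegularity.Theorems.ScenarioCensus.EulerianPincer

open Literature.Analysis Literature.Analysis.FluidPDE
open Summit.NavierStokesRegularity.NavierStokesRegularity.Theorems

/-! ### The EULERIAN read-outs (NEW): the fixed-point rate of the enstrophy density against the self-similar rate -/

/-- **EULERIAN EBB read-out** (time-dependent, weight 6 jointly with the lag `τ`):
`ebbOf θ (τ; v, L, H, K) = ⟪curl L, curl K − curl (H v) + L (curl L)⟫ − θ τ⁻¹ ‖curl L‖²`; at `x`, for a `C³` field `v`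
with `L = ∇v(x)`, `H = ∇²v(x)`, `K = Σᵢ D³v(x) eᵢ eᵢ`, this is `⟪ω, Δω − (v·∇)ω + (ω·∇)v⟫ − θ|ω|²/τ`, i.e. — through the
unit-viscosity vorticity equation — `½ ∂ₜ|ω|² − θ |ω|²/τ`: HALF THE EULERIAN (fixed-point) RATE of the enstrophy
density, charged only in excess of the fraction `θ` of the self-similar rate `|ω|²/τ`. -/
def ebbOf (θ τ : ℝ) (v : LiouvilleSocket.E3) (L : LiouvilleSocket.E3 →L[ℝ] LiouvilleSocket.E3) (H : LiouvilleSocket.Hess) (K : LiouvilleSocket.E3 →L[ℝ] LiouvilleSocket.E3) : ℝ :=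
  ⟪curlCLM L, FrozenTop.vortOf v L H K⟫ - θ * (τ⁻¹ * ‖curlCLM L‖ ^ 2)

/-- **EULERIAN FLARE read-out**: `flareOf κ (τ; v, L, H, K) = κ τ⁻¹ ‖curl L‖² − ⟪curl L, curl K − curl (H v) + L (curl L)⟫`
(`= κ|ω|²/τ − ½ ∂ₜ|ω|²`: the DEFICIT of the Eulerian rate below the fraction `κ` of the self-similar rate). -/
def flareOf (κ τ : ℝ) (v : LiouvilleSocket.E3) (L : LiouvilleSocket.E3 →L[ℝ] LiouvilleSocket.E3) (H : LiouvilleSocket.Hess) (K : LiouvilleSocket.E3 →L[ℝ] LiouvilleSocket.E3) : ℝ :=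
  -ebbOf κ τ v L H K

/-- Joint `𝒦`-homogeneity: `ebbOf θ (τ; a v, a²L, a³H, a⁴K) = a⁶ · ebbOf θ (a²τ; v, L, H, K)` (`a, τ > 0`). -/
theorem ebbOf_smul {a τ : ℝ} (ha : 0 < a) (hτ : 0 < τ) (θ : ℝ) (v : LiouvilleSocket.E3) (L : LiouvilleSocket.E3 →L[ℝ] LiouvilleSocket.E3) (H : LiouvilleSocket.Hess)
    (K : LiouvilleSocket.E3 →L[ℝ] LiouvilleSocket.E3) :
    ebbOf θ τ (a • v) (a ^ 2 • L) (a ^ 3 • H) (a ^ 4 • K) = a ^ 6 * ebbOf θ (a ^ 2 * τ) v L H K := by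
  have ha' : a ≠ 0 := ha.ne'
  have hτ' : τ ≠ 0 := hτ.ne'
  rw [ebbOf, ebbOf, FrozenTop.vortOf_smul]
  simp only [ContinuousLinearMap.map_smul, real_inner_smul_left, real_inner_smul_right, norm_smul,
    mul_pow, Real.norm_eq_abs, sq_abs, mul_inv]
  field_simp

/-- Joint `𝒦`-homogeneity of the flare read-out. -/
theorem flareOf_smul {a τ : ℝ} (ha : 0 < a) (hτ : 0 < τ) (κ : ℝ) (v : LiouvilleSocket.E3) (L : LiouvilleSocket.E3 →L[ℝ] LiouvilleSocket.E3) (H : LiouvilleSocket.Hess)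
    (K : LiouvilleSocket.E3 →L[ℝ] LiouvilleSocket.E3) :
    flareOf κ τ (a • v) (a ^ 2 • L) (a ^ 3 • H) (a ^ 4 • K) = a ^ 6 * flareOf κ (a ^ 2 * τ) v L H K := by
  rw [flareOf, flareOf, ebbOf_smul ha hτ, mul_neg]

/-- Continuity of the ebb read-out on `{τ > 0}` (jointly in the lag and the data). -/
theorem continuousOn_ebbOf (θ : ℝ) :
    ContinuousOn (fun q : ℝ × LiouvilleSocket.E3 × (LiouvilleSocket.E3 →L[ℝ] LiouvilleSocket.E3) × LiouvilleSocket.Hess × (LiouvilleSocket.E3 →L[ℝ] LiouvilleSocket.E3) =>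
      ebbOf θ q.1 q.2.1 q.2.2.1 q.2.2.2.1 q.2.2.2.2) {q | 0 < q.1} := by
  have hc : Continuous (curlCLM : (LiouvilleSocket.E3 →L[ℝ] LiouvilleSocket.E3) →L[ℝ] LiouvilleSocket.E3) := curlCLM.continuous
  have hL : Continuous fun q : ℝ × LiouvilleSocket.E3 × (LiouvilleSocket.E3 →L[ℝ] LiouvilleSocket.E3) × LiouvilleSocket.Hess × (LiouvilleSocket.E3 →L[ℝ] LiouvilleSocket.E3) => curlCLM q.2.2.1 :=
    hc.comp continuous_snd.snd.fst
  have hV : Continuous fun q : ℝ × LiouvilleSocket.E3 × (LiouvilleSocket.E3 →L[ℝ] LiouvilleSocket.E3) × LiouvilleSocket.Hess × (LiouvilleSocket.E3 →L[ℝ] LiouvilleSocket.E3) =>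
      FrozenTop.vortOf q.2.1 q.2.2.1 q.2.2.2.1 q.2.2.2.2 := FrozenTop.continuous_vortOf.comp continuous_snd
  have hP : Continuous fun q : ℝ × LiouvilleSocket.E3 × (LiouvilleSocket.E3 →L[ℝ] LiouvilleSocket.E3) × LiouvilleSocket.Hess × (LiouvilleSocket.E3 →L[ℝ] LiouvilleSocket.E3) =>
      ⟪curlCLM q.2.2.1, FrozenTop.vortOf q.2.1 q.2.2.1 q.2.2.2.1 q.2.2.2.2⟫ := hL.inner hV
  have hN : Continuous fun q : ℝ × LiouvilleSocket.E3 × (LiouvilleSocket.E3 →L[ℝ] LiouvilleSocket.E3) × LiouvilleSocket.Hess × (LiouvilleSocket.E3 →L[ℝ] LiouvilleSocket.E3) => ‖curlCLM q.2.2.1‖ ^ 2 :=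
    hL.norm.pow 2
  have hinv : ContinuousOn (fun q : ℝ × LiouvilleSocket.E3 × (LiouvilleSocket.E3 →L[ℝ] LiouvilleSocket.E3) × LiouvilleSocket.Hess × (LiouvilleSocket.E3 →L[ℝ] LiouvilleSocket.E3) => q.1⁻¹) {q | 0 < q.1} :=
    continuousOn_fst.inv₀ fun q hq => (ne_of_gt hq)
  exact hP.continuousOn.sub (continuousOn_const.mul (hinv.mul hN.continuousOn))

/-- Continuity of the flare read-out on `{τ > 0}`. -/
theorem continuousOn_flareOf (κ : ℝ) :
    ContinuousOn (fun q : ℝ × LiouvilleSocket.E3 × (LiouvilleSocket.E3 →L[ℝ] LiouvilleSocket.E3) × LiouvilleSocket.Hess × (LiouvilleSocket.E3 →L[ℝ] LiouvilleSocket.E3) =>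
      flareOf κ q.1 q.2.1 q.2.2.1 q.2.2.2.1 q.2.2.2.2) {q | 0 < q.1} :=
  (continuousOn_ebbOf κ).neg

/-- Continuity in the data at a FIXED lag (any `τ`; Lean's `0⁻¹ = 0`). -/
theorem continuous_ebbOf_fixed (θ τ : ℝ) :
    Continuous fun q : LiouvilleSocket.E3 × (LiouvilleSocket.E3 →L[ℝ] LiouvilleSocket.E3) × LiouvilleSocket.Hess × (LiouvilleSocket.E3 →L[ℝ] LiouvilleSocket.E3) => ebbOf θ τ q.1 q.2.1 q.2.2.1 q.2.2.2 := by
  have hc : Continuous (curlCLM : (LiouvilleSocket.E3 →L[ℝ] LiouvilleSocket.E3) →L[ℝ] LiouvilleSocket.E3) := curlCLM.continuous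
  have hL : Continuous fun q : LiouvilleSocket.E3 × (LiouvilleSocket.E3 →L[ℝ] LiouvilleSocket.E3) × LiouvilleSocket.Hess × (LiouvilleSocket.E3 →L[ℝ] LiouvilleSocket.E3) => curlCLM q.2.1 :=
    hc.comp continuous_snd.fst
  exact (hL.inner FrozenTop.continuous_vortOf).sub (continuous_const.mul (continuous_const.mul (hL.norm.pow 2)))

/-- Continuity of the flare read-out in the data at a fixed lag. -/
theorem continuous_flareOf_fixed (κ τ : ℝ) :
    Continuous fun q : LiouvilleSocket.E3 × (LiouvilleSocket.E3 →L[ℝ] LiouvilleSocket.E3) × LiouvilleSocket.Hess × (LiouvilleSocket.E3 →L[ℝ] LiouvilleSocket.E3) => flareOf κ τ q.1 q.2.1 q.2.2.1 q.2.2.2 :=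
  (continuous_ebbOf_fixed κ τ).neg

/-- `ebbOf` vanishes at the zero datum. -/
theorem ebbOf_zero (θ τ : ℝ) : ebbOf θ τ 0 0 0 0 = 0 := by simp [ebbOf, FrozenTop.vortOf]

/-- `flareOf` vanishes at the zero datum. -/
theorem flareOf_zero (κ τ : ℝ) : flareOf κ τ 0 0 0 0 = 0 := by rw [flareOf, ebbOf_zero, neg_zero]

/-- The ebb read-out of `(v, ∇v, ∇²v, K)(x)` at lag `τ` is `⟪ω, Δω − (v·∇)ω + (ω·∇)v⟫ − θ τ⁻¹ |ω|²` at `x` (`C³` fields). -/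
theorem ebb_eq (θ τ : ℝ) {v : LiouvilleSocket.E3 → LiouvilleSocket.E3} (hv : ContDiff ℝ 3 v) (x : LiouvilleSocket.E3) :
    ⟪curl v x, (Δ (curl v)) x - convect v (curl v) x + convect (curl v) v x⟫ - θ * (τ⁻¹ * ‖curl v x‖ ^ 2) =
      ebbOf θ τ (v x) (fderiv ℝ v x) (fderiv ℝ (fderiv ℝ v) x) (FrozenTop.lapD v x) := by
  rw [ebbOf, ← FrozenTop.transport_eq_vortOf hv x]
  rfl

/-- `ν`-normalisation: `ν³ · ebbOf θ (νσ; u/ν, ∇u/ν, ∇²u/ν, K/ν) = ⟪ω, ν Δω − (u·∇)ω + (ω·∇)u⟫ − θ σ⁻¹ |ω|²`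
(`ν, σ > 0`, `C³` fields). -/
theorem nu_readout_ebbOf {ν σ : ℝ} (hν : 0 < ν) (hσ : 0 < σ) (θ : ℝ) {v : LiouvilleSocket.E3 → LiouvilleSocket.E3} (hv : ContDiff ℝ 3 v)
    (x : LiouvilleSocket.E3) :
    ν ^ 3 * ebbOf θ (ν * σ) (ν⁻¹ • v x) (ν⁻¹ • fderiv ℝ v x) (ν⁻¹ • fderiv ℝ (fderiv ℝ v) x)
      (ν⁻¹ • FrozenTop.lapD v x) =
      ⟪curl v x, ν • (Δ (curl v)) x - convect v (curl v) x + convect (curl v) v x⟫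
        - θ * (σ⁻¹ * ‖curl v x‖ ^ 2) := by
  have hν' : ν ≠ 0 := hν.ne'
  have hσ' : σ ≠ 0 := hσ.ne'
  have e : FrozenTop.vortOf (ν⁻¹ • v x) (ν⁻¹ • fderiv ℝ v x) (ν⁻¹ • fderiv ℝ (fderiv ℝ v) x) (ν⁻¹ • FrozenTop.lapD v x) =
      (ν⁻¹ * ν⁻¹) • (ν • (Δ (curl v)) x - convect v (curl v) x + convect (curl v) v x) := by
    rw [FrozenTop.laplacian_curl_eq hv, FrozenTop.convect_curl_eq (hv.of_le (by norm_cast)), FrozenTop.convect_curl_self]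
    simp only [FrozenTop.vortOf, _root_.smul_apply, ContinuousLinearMap.map_smul, smul_sub, smul_add, smul_smul]
    rw [show ν⁻¹ * ν⁻¹ * ν = ν⁻¹ by field_simp]
  have ec : curlCLM (ν⁻¹ • fderiv ℝ v x) = ν⁻¹ • curl v x := by
    rw [ContinuousLinearMap.map_smul, IntegratedStretch.curl_apply_eq]
  rw [ebbOf, e, ec]
  simp only [real_inner_smul_left, real_inner_smul_right, norm_smul, mul_pow, Real.norm_eq_abs, sq_abs, mul_inv]
  field_simp

/-- `ν`-normalisation of the flare read-out. -/
theorem nu_readout_flareOf {ν σ : ℝ} (hν : 0 < ν) (hσ : 0 < σ) (κ : ℝ) {v : LiouvilleSocket.E3 → LiouvilleSocket.E3} (hv : ContDiff ℝ 3 v)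
    (x : LiouvilleSocket.E3) :
    ν ^ 3 * flareOf κ (ν * σ) (ν⁻¹ • v x) (ν⁻¹ • fderiv ℝ v x) (ν⁻¹ • fderiv ℝ (fderiv ℝ v) x)
      (ν⁻¹ • FrozenTop.lapD v x) =
      κ * (σ⁻¹ * ‖curl v x‖ ^ 2)
        - ⟪curl v x, ν • (Δ (curl v)) x - convect v (curl v) x + convect (curl v) v x⟫ := by
  rw [flareOf, mul_neg, nu_readout_ebbOf hν hσ κ hv x]
  ring

/-! ### Constant levels; the sharp Type-I constant of a Type-I blow-up -/

/-! ### The vorticity-equation dictionary: dynamic = kinematic for classical solutions -/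

end Summit.NavierStokesRegularity.NavierStokesRegularity.Theorems.ScenarioCensus.EulerianPincer

end
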